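import Summits.HubbardSuperconductivity.HubbardSuperconductivity.Theorems.AnisotropyChordTransferFibre3FamilyALemmas
import Literature.MathematicalPhysics.QuantumFieldTheory.Balaban1983to89.B4Strip

/-!
# Route `AnisotropyChord` / H0 rotor rung: PartN38 — the monotone brackets `MonotoneBrackets` PROVED

Typed target `MonotoneBrackets` of `…Fibre3FamilyALemmas` (PORT PartN38, theory seat `hubbard-h0-rotor-theory-1` g21, memo 21
§316; the standard one-variable brackets used by the family-A evaluators):
`y − y³/6 ≤ arsinh y ≤ y` (`y ≥ 0`), `0.8813·y ≤ arsinh y` (`0 ≤ y ≤ 1`), `arcsin z ≤ z/√(1−z²)` (`0 ≤ z < 1`),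
`sin x/x` antitone on `(0, π]`, and Jordan `2x/π ≤ sin x` on `[0, π/2]`.
Proofs: mean-value monotonicity (`monotone_of_deriv_nonneg` with `(s−1)²(s+2) ≥ 0`, `s = √(1+y²)`); concavity of `arsinh`
on `[0,∞)` (`AntitoneOn.concaveOn_of_deriv`) + the chord at `y = 1` + `arsinh 1 = log(1+√2) > 0.8813` (`Real.exp_bound'` with ten
Taylor terms and `√2 > 1.414213`); `x ≤ tan x` (`Real.le_tan`, `Real.tan_arcsin`); `x cos x ≤ sin x` on `(0,π)`
(`antitoneOn_of_deriv_nonpos`); `Real.mul_le_sin`.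
Prover seat `hubbard-h0-rotor-p1` g23; helper for stmt-HubbardSuperconductivity-19089 (`--supports`).
-/

set_option linter.dupNamespace false
set_option autoImplicit false

noncomputable section

open scoped BigOperators

namespace Summit.HubbardSuperconductivity.HubbardSuperconductivity.Theorems.AnisotropyChord.Transfer.Fibre3

/-! ## `arsinh` brackets -/

/-- the derivative inequality `1 − y²/2 ≤ (√(1+y²))⁻¹` (from `(s−1)²(s+2) ≥ 0`, `s = √(1+y²)`). [folklore] -/
theorem one_sub_sq_half_le_inv_sqrt (y : ℝ) : 1 - y ^ 2 / 2 ≤ (Real.sqrt (1 + y ^ 2))⁻¹ := by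
  set s := Real.sqrt (1 + y ^ 2) with hs
  have hs0 : 0 < s := Real.sqrt_pos.mpr (by positivity)
  have hss : s ^ 2 = 1 + y ^ 2 := by rw [hs, Real.sq_sqrt (by positivity)]
  rw [show 1 - y ^ 2 / 2 = (3 - s ^ 2) / 2 by rw [hss]; ring, div_le_iff₀ (by norm_num : (0 : ℝ) < 2),
    ← sub_nonneg]
  have h : s⁻¹ * 2 - (3 - s ^ 2) = (s - 1) ^ 2 * (s + 2) / s := by
    field_simp; ring
  rw [h]
  positivity

/-- `y − y³/6 ≤ arsinh y` for `y ≥ 0`. [folklore] -/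
theorem self_sub_cube_le_arsinh {y : ℝ} (hy : 0 ≤ y) : y - y ^ 3 / 6 ≤ Real.arsinh y := by
  set F : ℝ → ℝ := fun x => Real.arsinh x - x + x ^ 3 / 6 with hF
  have hd : ∀ x : ℝ, HasDerivAt F ((Real.sqrt (1 + x ^ 2))⁻¹ - 1 + x ^ 2 / 2) x := by
    intro x
    have h1 := Real.hasDerivAt_arsinh x
    have h2 : HasDerivAt (fun x : ℝ => x) 1 x := hasDerivAt_id' x
    have h3 : HasDerivAt (fun x : ℝ => x ^ 3 / 6) (3 * x ^ 2 / 6) x := by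
      have := (hasDerivAt_pow 3 x).div_const 6
      simpa using this
    rw [hF]
    exact ((h1.sub h2).add h3).congr_deriv (by ring)
  have hmono : Monotone F := by
    refine monotone_of_deriv_nonneg (fun x => (hd x).differentiableAt) fun x => ?_
    rw [(hd x).deriv]
    have := one_sub_sq_half_le_inv_sqrt x
    linarith
  have h0 : F 0 = 0 := by simp [hF]
  have := hmono hy
  rw [h0] at this
  simp only [hF] at this
  linarith

/-- `arsinh` is concave on `[0, ∞)`. [folklore] -/
theorem concaveOn_arsinh_Ici : ConcaveOn ℝ (Set.Ici (0 : ℝ)) Real.arsinh := by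
  refine AntitoneOn.concaveOn_of_deriv (convex_Ici 0) Real.continuous_arsinh.continuousOn
    Real.differentiable_arsinh.differentiableOn ?_
  rw [interior_Ici]
  intro a ha b hb hab
  rw [(Real.hasDerivAt_arsinh a).deriv, (Real.hasDerivAt_arsinh b).deriv]
  have ha0 : 0 < a := ha
  apply inv_anti₀ (Real.sqrt_pos.mpr (by positivity))
  exact Real.sqrt_le_sqrt (by nlinarith)

/-- `log(1 + √2) > 0.8813` (`exp` with ten Taylor terms; `√2 > 1.414213`). [folklore] -/
theorem log_one_add_sqrt_two_gt : (0.8813 : ℝ) ≤ Real.log (1 + Real.sqrt 2) := by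
  have hs : (1.414213 : ℝ) < Real.sqrt 2 := by
    rw [Real.lt_sqrt (by norm_num)]; norm_num
  have hpos : (0 : ℝ) < 1 + Real.sqrt 2 := by positivity
  rw [Real.le_log_iff_exp_le hpos]
  have hb := Real.exp_bound' (x := (0.8813 : ℝ)) (by norm_num) (by norm_num) (n := 10) (by norm_num)
  have hnum : (∑ m ∈ Finset.range 10, (0.8813 : ℝ) ^ m / m.factorial) + (0.8813 : ℝ) ^ 10 * (10 + 1) / (Nat.factorial 10 * 10)
      < 1 + 1.414213 := by
    simp only [Finset.sum_range_succ, Finset.sum_range_zero, Nat.factorial]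
    norm_num
  have hb' : Real.exp 0.8813 ≤ (∑ m ∈ Finset.range 10, (0.8813 : ℝ) ^ m / m.factorial)
      + (0.8813 : ℝ) ^ 10 * (10 + 1) / (Nat.factorial 10 * 10) := by exact_mod_cast hb
  linarith

/-- `arsinh 1 = log(1 + √2)`. [folklore] -/
theorem arsinh_one : Real.arsinh 1 = Real.log (1 + Real.sqrt 2) := by
  unfold Real.arsinh; norm_num

/-- `0.8813·y ≤ arsinh y` on `[0,1]` (chord of the concave `arsinh`). [folklore] -/
theorem mul_le_arsinh {y : ℝ} (hy0 : 0 ≤ y) (hy1 : y ≤ 1) : 0.8813 * y ≤ Real.arsinh y := by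
  have hc := concaveOn_arsinh_Ici.2 (Set.mem_Ici.2 (le_refl (0 : ℝ))) (Set.mem_Ici.2 (zero_le_one' ℝ))
    (sub_nonneg.2 hy1) hy0 (by ring)
  simp only [smul_eq_mul, mul_zero, mul_one, Real.arsinh_zero, zero_add] at hc
  calc 0.8813 * y ≤ Real.arsinh 1 * y := by
        refine mul_le_mul_of_nonneg_right ?_ hy0
        rw [arsinh_one]; exact log_one_add_sqrt_two_gt
    _ = y * Real.arsinh 1 := mul_comm _ _
    _ ≤ Real.arsinh y := hc

/-! ## `arcsin`, `sin x / x`, Jordan -/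

/-- `arcsin z ≤ z/√(1−z²)` for `0 ≤ z < 1` (`x ≤ tan x`). [folklore] -/
theorem arcsin_le_div_sqrt {z : ℝ} (hz0 : 0 ≤ z) (hz1 : z < 1) : Real.arcsin z ≤ z / Real.sqrt (1 - z ^ 2) := by
  rw [← Real.tan_arcsin]
  exact Real.le_tan (Real.arcsin_nonneg.2 hz0) (Real.arcsin_lt_pi_div_two.2 hz1)

/-- `x cos x ≤ sin x` on `(0, π)`. [folklore] -/
theorem mul_cos_le_sin {x : ℝ} (hx0 : 0 < x) (hxπ : x < Real.pi) : x * Real.cos x ≤ Real.sin x := by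
  by_cases h : x < Real.pi / 2
  · have hc : 0 < Real.cos x := Real.cos_pos_of_mem_Ioo ⟨by linarith, h⟩
    have ht := Real.le_tan hx0.le h
    rw [Real.tan_eq_sin_div_cos, le_div_iff₀ hc] at ht
    linarith
  · have h' : Real.pi / 2 ≤ x := le_of_not_gt h
    have hc : Real.cos x ≤ 0 := Real.cos_nonpos_of_pi_div_two_le_of_le h' (by linarith)
    have hs : 0 ≤ Real.sin x := Real.sin_nonneg_of_nonneg_of_le_pi hx0.le hxπ.le
    nlinarith

/-- `sin x / x` is antitone on `(0, π]`. [folklore] -/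
theorem antitoneOn_sin_div : AntitoneOn (fun x : ℝ => Real.sin x / x) (Set.Ioc 0 Real.pi) := by
  have hd : ∀ x : ℝ, x ≠ 0 → HasDerivAt (fun x : ℝ => Real.sin x / x) ((Real.cos x * x - Real.sin x * 1) / x ^ 2) x :=
    fun x hx => (Real.hasDerivAt_sin x).div (hasDerivAt_id x) hx
  refine antitoneOn_of_deriv_nonpos (convex_Ioc 0 Real.pi) ?_ ?_ ?_
  · exact Real.continuous_sin.continuousOn.div continuousOn_id fun x hx => ne_of_gt hx.1
  · rw [interior_Ioc]
    intro x hx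
    exact ((hd x (ne_of_gt hx.1)).differentiableAt).differentiableWithinAt
  · rw [interior_Ioc]
    intro x hx
    rw [(hd x (ne_of_gt hx.1)).deriv]
    have h := mul_cos_le_sin hx.1 hx.2
    apply div_nonpos_iff.mpr
    exact Or.inr ⟨by linarith, sq_nonneg x⟩

/-! ## `MonotoneBrackets` -/

/-- ★ **`MonotoneBrackets` holds.** [folklore] -/
theorem monotoneBrackets_holds : MonotoneBrackets := by
  refine ⟨fun y hy => ⟨self_sub_cube_le_arsinh hy,
    Literature.MathematicalPhysics.QuantumFieldTheory.Balaban1983to89.B4Strip.arsinh_le_self hy⟩, fun y hy0 hy1 => mul_le_arsinh hy0 hy1,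
    fun z hz0 hz1 => arcsin_le_div_sqrt hz0 hz1, antitoneOn_sin_div, fun x hx hx' => ?_⟩
  rw [show 2 * x / Real.pi = 2 / Real.pi * x by ring]
  exact Real.mul_le_sin hx hx'

end Summit.HubbardSuperconductivity.HubbardSuperconductivity.Theorems.AnisotropyChord.Transfer.Fibre3

end
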